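import Summits.QuantumFields.YangMills.Theorems.FluctuationComparisonRegPrIntLS2BetaChartReadDescentOntoExpPoint
import Summits.QuantumFields.YangMills.Theorems.FluctuationComparisonRegPrIntLS2BetaResidualGauge
import Summits.QuantumFields.YangMills.Theorems.FluctuationComparisonRegPrIntLS2BetaSmallBondGaugeToronObstruction
import Summits.QuantumFields.YangMills.Theorems.FluctuationComparisonRegPrIntLS2BetaLiftLadderCombRow
import Summits.QuantumFields.YangMills.Theorems.FluctuationComparisonRegPrIntLS2BetaGeodesicJensenLift
import Literature.MathematicalPhysics.QuantumFieldTheory.Balaban1983to89.LatticeFieldCalculus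
import Literature.MathematicalPhysics.QuantumFieldTheory.Balaban1983to89.T3DescentFibreTower
import Literature.MathematicalPhysics.QuantumFieldTheory.Balaban1983to89.B10Eq18SigmaSU2Window
import HarnessLib

/-!
# S2β · HAZARD «L2-GAUGE» (NEGATIVE KNOWLEDGE) — THE NAKED CHART TOWER DOES NOT ℓ²-CONTRACT: a RESIDUAL single-site gauge bump at a
# block centre keeps `Σ_{b : PBond (F.P K) i} ‖X i b‖² = Σ_ℓ ‖ζ ℓ‖²` at EVERY level `i ≤ j` with `REL = 0`, so the displayed (L2-TOWER) letter
# `Σ_{b : PBond (F.P K) j} ‖X j b‖² ≤ C₂·L^{−j}·Σ_ℓ‖ζ ℓ‖² + C₂′·L^{2(K−J)−j}·REL` is FALSE for ✓`linBudget_of_chartTower`'s `hXdef` tower `X`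

Cell `ym3-torus` (YM ladder rung R3 = continuum `SU(2)` Yang–Mills on the three-torus at fixed lattice data — a RUNG: NOT d = 4, NOT infinite volume, NOT
a mass gap, NOT Clay).  Width seat «width 20» `ym3-torus-px20` (gen 25), FREE px helper on crux `stmt-QuantumFields-20520`, LINE g18-1 S2β.  HAZARD-CANDIDATE
«L2-GAUGE» posted 2026-09-01T01:19:38Z; CONFIRMED by the architect (px17 g23 RULING «L2-GAUGE» 01:24:54Z), the desk (RULING №128 01:23:33Z: «(L2-TOWER) as
displayed is STRUCK from plan (3)»), px12 g27 (01:23:05Z, the (L2-TOWER) holder: «GO (N1)+(N2) from me») and px21 g26; px10 g26 WITHDREW ⧗`Elin_le_purse` f75d22d3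
(which displayed the letter) and re-cut on px12's (L2-VOL) volume road.  This file is the KERNEL form of the hazard (genre of ✓p838309 (y) ∕ ✓`not_forall_guard_arcLetter4`):
`--kind proof --supports stmt-QuantumFields-20520 --as helper`, count-neutral, DEFINITION-FREE (0 `def`, 0 `instance`, 0 `notation`, 0 `sorry`, default heartbeats).

THE MECHANISM (one line): block averaging is COVARIANT — `Ū^i(h•U₀) = (transfUp h i)•Ū^iU₀` (lit ✓`T4Continuum.iter_gaugeAct`, [Balaban1985Averaging] (11)) — and
`transfUp h i = h ∘ emb^i`; a gauge transformation supported at ONE finest site `x₀ = emb^j(0)` therefore reappears, undiluted, as the single-site bump at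
`emb^{j−i}(0)` of every level `i ≤ j` and vanishes above `j` (the origin of `T⁽ʲ⁾` is no centre).  Gauge modes are TRANSPORTED by the averaging, not averaged:
Jensen's `L^{−1}` bites only transverse to them.  Hence NO edition of an `L^{−j}`-decaying ℓ² letter holds for the naked relative field under (T) + (BKG) + fibre +
`histGood`; decay lives only under a level-wise gauge condition ((REG)@rep ∕ (RES-u)-class — the orbit infimum `⨅_{w residual}` of the body kills the bump).

WHAT IS PROVED (sorry-free).
§1 (generic lattice `P`, `SU(2)`): ★`norm_logVec_rel_gaugeAct_bump` — for `h = (g at z, 1 elsewhere)` and ANY `V`, `arc((h•V) b·(V b)⁻¹) = arc g` on the `2d` bonds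
   touching `z`, `0` elsewhere; ★★`sum_sq_norm_logVec_rel_gaugeAct_bump` — `Σ_{b : PBond P i} arc² = 2d·(arc g)²`.
§2 (generic `P`, generic group): `emb_const_centre` (`emb (const (L^n−1)∕2) = const (L^{n+1}−1)∕2`, odd `L`, standing range), `emb_ne_const_zero`;
   ★`transfUp_bump_of_le` — `transfUp h i` IS the bump at `const (L^{j−i}−1)∕2` for `i ≤ j`; ★`transfUp_bump_of_lt` ∕ `transfUp_bump_eq_one` — `≡ 1` for `i > j`.
§3 (`T3Family`, `ℰp`): `expPoint_logVec_rel_mul_eq` (`e^{ζ}U₀ = h•U₀` for `ζ ℓ := logVec((h•U₀) ℓ·(U₀ ℓ)⁻¹)`); ★★★`sum_sq_relTower_bump_of_le` — for ANY background `U₀`,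
   `Σ_{b : PBond (F.P K) i} arc(Ū^i(h•U₀) b·(Ū^iU₀ b)⁻¹)² = 2·3·(arc g)²` at every `i ≤ j` (the `i = 0` case is `Σ_ℓ ‖ζ ℓ‖²`); ★★`iter_bump_of_lt` (`Ū^i(h•U₀) = Ū^iU₀`,
   `i > j`); ★★`descendTo_bump_eq` — the bump is RESIDUAL: `descendTo (h•U₀) = descendTo U₀` whenever `j < K − J` (✓`residual_of_descTransf_eq_one`).
§4 `iter_blockAvg_one` (`Ū^t 1 = 1`, lit ✓`avgFun_one`); ★★★**`not_l2Tower_contraction (L) (hL : Odd L ∧ 1 < L)`**: `¬ ∃ C₂ C₂′, ∀ F (F.L = L) J K hJK θ>0 C_B α ≥ 0,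
   ∀ U₀ ∈ histGood, (BKG-class plaquettes of the background tower) → ∀ ζ (‖ζ‖ ≤ π, e^ζU₀ ∈ histGood, SAME FIBRE, window 1∕4 at every level t ≤ K−J) → ∀ j ≤ K−J,
   Σ_{b : PBond (F.P K) j} ‖X j b‖² ≤ C₂·(L⁻¹)^j·Σ_ℓ‖ζ ℓ‖² + C₂′·L^{2(K−J)−j}·REL` with `X j b` = ✓`linBudget_of_chartTower`'s `hXdef` text
   `⟨su2Coord (rev (logVec (su2Quat (Ū^j(e^ζU₀) b·(Ū^jU₀ b)⁻¹)))), _⟩` VERBATIM and `REL = Σ_p (1 − reTr((U₀(∂p))⁻¹·(e^ζU₀)(∂p)))` (the purse's second currency).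
   Witness: `F = ⟨L, hL, m := 1⟩`, `J = 0`, `K = j+1` with `L^j > C₂`, flat `U₀ = 1`, `θ ≡ 1`, `C_B = α = 0`, `g = exp(A)`, `A = (1∕4)e₀`: every hypothesis holds
   (§3, lit ✓`gaugeAct_mem_histGood_iff`, ✓`plaqSmall_one`), `REL = 0`, `Σ_b‖X j b‖² = Σ_ℓ‖ζ ℓ‖² = 6·(1∕4)²`, and `6∕16 ≤ C₂·L^{−j}·6∕16` contradicts `C₂ < L^j`.
SCOPE (px21 g26 01:34:12Z, architect GO 01:33:26Z).  The refuted letter lives on the NAKED pair `(U₀, ζ)` — NO AxStage package: the lane's datum prefix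
`∀ wt lift U₁ g g₀, … → U₀ = ((g 0)⁻¹·(g₀ 0))•U₁ → …` (hD, hDBX⁗, hRκ, hRρ, KEYREL) EXCLUDES the residual bump (the package pins the relative residual gauge: at `(w•U₀, U₀)` it
forces `w ∈ Stab U₀`), so NO packaged socket is touched by this file; only un-packaged displays ((L2-TOWER) as struck, and any chord letter on ✓`linBudget_of_chartTower`'s bare
binders) are.  USE.  `E_lin` of ✓`Bsrc_split_le` rides px12's (L2-VOL) volume road (⧗px10 `Elin_le_Sprime`) instead; any ℓ²-DECAY statement belongs to the representative
((L2-TOWER)@rep, px12 g27; (RES-u)∕(REG)@rep, plan (3) v3) and must carry a gauge clause that the §3 bump fails.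
HONEST SCOPE.  Finite-lattice bookkeeping (coordinates of the nested centres), covariance of the printed averaging by name, one line of `SU(2)` group algebra, and a
counterexample to a letter that was DISPLAYED on the bus but never landed; nothing of Bałaban's renormalisation-group analysis is asserted or proved ([Balaban1985Averaging]
(11)–(13) p.19 is the covariance the witness rides; [Balaban1985RegularSpaces] (1.29) p.81 is print's cure — the regular, gauge-fixed representative); (T), (BKG), (REG),
(RES-u), (L2-VOL), (L2-TOWER)@rep, the windows, GAP♯∘ (`stub_uniformFibreGapOrbit`, registry `Lines/semiclassical_s2beta.lean` 3732b7df UNTOUCHED, 0∕5), the five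
registered stubs, S2β, crux 20520, 19936, 19200 and `YM3TorusSU2` are NOT proved and NOT refuted — only the one displayed letter is; no registered stub is closed;
rung R3 = SU(2) YM₃ on T³ at fixed lattice data — NOT d = 4, NOT infinite volume, NOT a mass gap, NOT Clay; the Yang–Mills mass gap is NOT proved.
-/

set_option autoImplicit false
noncomputable section
open scoped Matrix.Norms.L2Operator Real
open Finset
namespace Summit.QuantumFields.YangMills.Theorems.FluctuationComparisonRegPrIntLS2BetaL2TowerContractionFalse

open Literature.MathematicalPhysics.QuantumLattice (su2Quat)
open Literature.MathematicalPhysics.QuantumFieldTheory.Balaban1983to89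
open Literature.MathematicalPhysics.QuantumFieldTheory.Balaban1983to89.T4Continuum
open Literature.MathematicalPhysics.QuantumFieldTheory.Balaban1983to89.T3ContinuumYM3Torus
open Literature.MathematicalPhysics.QuantumFieldTheory.Balaban1983to89.T3UnitScaleTilt (histGood)
open Literature.MathematicalPhysics.QuantumFieldTheory.Balaban1983to89.T3TiltDescent (descendTo)
open Literature.MathematicalPhysics.QuantumFieldTheory.Balaban1983to89.T3PrintedRegularOrbits (descTransf)
open Literature.MathematicalPhysics.QuantumFieldTheory.Balaban1983to89.T3UnitLawDensityEML (ℰp)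
open Literature.MathematicalPhysics.QuantumFieldTheory.Balaban1983to89.T4HaarSU2ExpChart (expPoint)
open Literature.MathematicalPhysics.QuantumFieldTheory.Balaban1983to89.T4ExpWindowSmallField (logVec expPoint_logVec norm_logVec_le_pi)
open Literature.MathematicalPhysics.QuantumFieldTheory.Balaban1983to89.HaarExponentialChart
open Literature.MathematicalPhysics.QuantumFieldTheory.Balaban1983to89.B10Eq18SigmaSU2 (su2Coord)
open Literature.MathematicalPhysics.QuantumFieldTheory.Balaban1983to89.B10Eq18SigmaSU2Haar (rev norm_rev)
open Literature.MathematicalPhysics.QuantumFieldTheory.Balaban1983to89.B10Eq18SigmaSU2Window (norm_su2Coord)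
open Summit.QuantumFields.YangMills.Theorems.FluctuationComparisonRegPrIntLS2BetaChartReadDescentOntoExpPoint (su2Coord_rev_mem_lie)
open Summit.QuantumFields.YangMills.Theorems.FluctuationComparisonRegPrIntLS2BetaSmallBondGaugeToronObstruction
  (norm_logVec_su2Quat_conj norm_logVec_su2Quat_one)
open Summit.QuantumFields.YangMills.Theorems.FluctuationComparisonRegPrIntLS2BetaLiftLadderCombRow (norm_logVec_su2Quat_inv)
open Summit.QuantumFields.YangMills.Theorems.FluctuationComparisonRegPrIntLS2BetaGeodesicJensenLift (norm_logVec_su2Quat_expPoint)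
open Summit.QuantumFields.YangMills.Theorems.FluctuationComparisonRegPrIntLS2BetaResidualGauge
  (residual_of_descTransf_eq_one gaugeAct_mem_histGood_iff)
/-! ## §1 One level: the relative field of a single-site gauge bump (generic lattice) -/
section OneLevel

variable {P : Params} {i : ℕ}

/-- ★ **THE RELATIVE FIELD OF A SINGLE-SITE GAUGE BUMP**: for the bump `h = (g at z, 1 elsewhere)`, the relative field `(h•V) b · (V b)⁻¹`
has arc `arc g` on the `2d` bonds touching `z` and `0` elsewhere (ANY background `V`). [cite: Balaban1985Averaging, (8) p.19] -/
theorem norm_logVec_rel_gaugeAct_bump (V : GaugeField P i (Matrix.specialUnitaryGroup (Fin 2) ℂ)) (z : Site P i)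
    (g : Matrix.specialUnitaryGroup (Fin 2) ℂ) (b : PBond P i) :
    ‖logVec (su2Quat (GaugeField.gaugeAct (fun x => if x = z then g else 1) V b * (V b)⁻¹))‖ =
      if b.src = z ∨ b.tgt = z then ‖logVec (su2Quat g)‖ else 0 := by
  simp only [GaugeField.gaugeAct]
  by_cases hs : b.src = z
  · have ht : ¬ b.tgt = z := fun h => B12SmallFieldDomain259.src_ne_tgt b (hs.trans h.symm)
    rw [if_pos hs, if_neg ht, if_pos (Or.inl hs), inv_one, mul_one, mul_inv_cancel_right]
  · by_cases ht : b.tgt = z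
    · rw [if_neg hs, if_pos ht, if_pos (Or.inr ht), one_mul, norm_logVec_su2Quat_conj, norm_logVec_su2Quat_inv]
    · rw [if_neg hs, if_neg ht, if_neg (not_or.mpr ⟨hs, ht⟩), one_mul, inv_one, mul_one, mul_inv_cancel, norm_logVec_su2Quat_one]

/-- ★★ **ITS ℓ² MASS IS `2d·(arc g)²` AT EVERY LEVEL** — `d` bonds out of `z`, `d` bonds into `z`, no others. [cite: Balaban1985Averaging, (5) p.18] -/
theorem sum_sq_norm_logVec_rel_gaugeAct_bump (V : GaugeField P i (Matrix.specialUnitaryGroup (Fin 2) ℂ)) (z : Site P i)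
    (g : Matrix.specialUnitaryGroup (Fin 2) ℂ) :
    ∑ b : PBond P i, ‖logVec (su2Quat (GaugeField.gaugeAct (fun x => if x = z then g else 1) V b * (V b)⁻¹))‖ ^ 2 =
      2 * (P.d : ℝ) * ‖logVec (su2Quat g)‖ ^ 2 := by
  simp_rw [norm_logVec_rel_gaugeAct_bump V z g]
  have hsq : ∀ b : PBond P i, (if b.src = z ∨ b.tgt = z then ‖logVec (su2Quat g)‖ else 0) ^ 2 =
      (if b.src = z then ‖logVec (su2Quat g)‖ ^ 2 else 0) + (if b.tgt = z then ‖logVec (su2Quat g)‖ ^ 2 else 0) := by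
    intro b
    by_cases hs : b.src = z
    · have ht : ¬ b.tgt = z := fun h => B12SmallFieldDomain259.src_ne_tgt b (hs.trans h.symm)
      simp [hs, ht]
    · by_cases ht : b.tgt = z <;> simp [hs, ht]
  simp_rw [hsq]
  -- bonds are (site, direction) pairs
  have key : ∀ f : Site P i → Fin P.d → ℝ, ∑ b : PBond P i, f b.src b.dir = ∑ x : Site P i, ∑ μ : Fin P.d, f x μ := by
    intro f
    rw [← Fintype.sum_prod_type']
    exact Fintype.sum_equiv (LatticeFieldCalculus.bondEquiv (P := P) (j := i)).symm _ _ (fun b => rfl)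
  have h1 : ∑ x : Site P i, (if x = z then ‖logVec (su2Quat g)‖ ^ 2 else (0 : ℝ)) = ‖logVec (su2Quat g)‖ ^ 2 := by
    rw [Finset.sum_ite_eq' Finset.univ z]; simp
  have h2 : ∀ μ : Fin P.d, ∑ x : Site P i, (if x.shift μ = z then ‖logVec (su2Quat g)‖ ^ 2 else (0 : ℝ)) = ‖logVec (su2Quat g)‖ ^ 2 := by
    intro μ
    have : ∀ x : Site P i, (x.shift μ = z) = (x = z.unshift μ) := by
      intro x; apply propext; constructor
      · intro h; rw [← h, Site.unshift_shift]
      · intro h; rw [h, Site.shift_unshift]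
    simp_rw [this]
    rw [Finset.sum_ite_eq' Finset.univ (z.unshift μ)]; simp
  refine (key (fun x μ => (if x = z then ‖logVec (su2Quat g)‖ ^ 2 else 0) + (if x.shift μ = z then ‖logVec (su2Quat g)‖ ^ 2 else 0))).trans ?_
  rw [Finset.sum_comm]
  simp_rw [Finset.sum_add_distrib, h1, h2]
  simp only [Finset.sum_const, Finset.card_univ, Fintype.card_fin, nsmul_eq_mul]
  ring

end OneLevel

/-! ## §2 The bump's ascent along the block centres: `transfUp` of the bump at `emb^j(0)` (generic lattice, generic group) -/
section Ascent

variable {P : Params} {G : Type*} [GaugeGroup G]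

/-- The centre recursion in coordinates: `emb (const ((L^n − 1)∕2)) = const ((L^{n+1} − 1)∕2)` (odd `L`; standing range, no wrap-around).
[cite: Balaban1987RG1, (0.1) p.251] -/
theorem emb_const_centre {i n : ℕ} (hi : i + 1 ≤ P.m + P.K) (hn : n + i + 1 ≤ P.m + P.K) :
    emb (fun _ : Fin P.d => (((P.L ^ n - 1) / 2 : ℕ) : ZMod (P.sitesPerDir (i + 1)))) =
      (fun _ : Fin P.d => (((P.L ^ (n + 1) - 1) / 2 : ℕ) : ZMod (P.sitesPerDir i))) := by
  funext μ
  have hL1 : 1 < P.L := P.hL.2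
  obtain ⟨b, hb⟩ : ∃ b, P.L = 2 * b + 1 := P.hL.1
  obtain ⟨a, ha⟩ : ∃ a, P.L ^ n = 2 * a + 1 := Odd.pow P.hL.1
  have hval : ((((P.L ^ n - 1) / 2 : ℕ) : ZMod (P.sitesPerDir (i + 1)))).val = (P.L ^ n - 1) / 2 := by
    rw [ZMod.val_natCast, Nat.mod_eq_of_lt]
    have h1 : P.L ^ n ≤ P.L ^ (P.m + P.K - (i + 1)) := Nat.pow_le_pow_right (by omega) (by omega)
    have h2 : P.sitesPerDir (i + 1) = 2 * P.L ^ (P.m + P.K - (i + 1)) := rfl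
    have h3 : 0 < P.L ^ (P.m + P.K - (i + 1)) := Nat.pow_pos (by omega)
    rw [h2]
    generalize P.L ^ n = N at h1 ⊢
    generalize P.L ^ (P.m + P.K - (i + 1)) = M at h1 h3 ⊢
    omega
  apply ZMod.val_injective
  rw [Site.val_emb hi, hval, ZMod.val_natCast, Nat.mod_eq_of_lt]
  · rw [pow_succ, ha, hb]
    have e1 : (2 * a + 1 - 1) / 2 = a := by omega
    have e2 : (2 * b + 1 - 1) / 2 = b := by omega
    have e3 : (2 * a + 1) * (2 * b + 1) = 2 * (a * (2 * b + 1) + b) + 1 := by ring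
    rw [e1, e2, e3]
    generalize a * (2 * b + 1) + b = c
    omega
  · have h1 : P.L ^ (n + 1) ≤ P.L ^ (P.m + P.K - i) := Nat.pow_le_pow_right (by omega) (by omega)
    have h2 : P.sitesPerDir i = 2 * P.L ^ (P.m + P.K - i) := rfl
    have h3 : 0 < P.L ^ (P.m + P.K - i) := Nat.pow_pos (by omega)
    rw [h2]
    generalize P.L ^ (n + 1) = N at h1 ⊢
    generalize P.L ^ (P.m + P.K - i) = M at h1 h3 ⊢
    omega

/-- No coarse centre is the origin: `emb x ≠ 0` (its label is `≥ (L−1)∕2 ≥ 1`). [cite: Balaban1987RG1, (0.1) p.251] -/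
theorem emb_ne_const_zero {j : ℕ} (hj : j + 1 ≤ P.m + P.K) (x : Site P (j + 1)) :
    emb x ≠ (fun _ : Fin P.d => (((P.L ^ (j - j) - 1) / 2 : ℕ) : ZMod (P.sitesPerDir j))) := by
  intro h
  have hL1 : 1 < P.L := P.hL.2
  obtain ⟨b, hb⟩ : ∃ b, P.L = 2 * b + 1 := P.hL.1
  have h1 := congrArg ZMod.val (congrFun h ⟨0, P.hd⟩)
  rw [Site.val_emb hj, Nat.sub_self, pow_zero, Nat.sub_self, Nat.zero_div, Nat.cast_zero, ZMod.val_zero] at h1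
  omega

/-- ★ **THE BUMP CLIMBS THE CENTRES**: for `h = (g at emb^j(0), 1 elsewhere)` on the finest lattice, `transfUp h i` is the bump at `emb^{j−i}(0)` of
`T⁽ⁱ⁾` for every `i ≤ j` (coordinates `(L^{j−i} − 1)∕2`). [cite: Balaban1985Averaging, (11)-(13) p.19] -/
theorem transfUp_bump_of_le {j : ℕ} (hj : j ≤ P.m + P.K) (g : G) :
    ∀ i, i ≤ j → ∀ x : Site P i,
      transfUp (fun x : Site P 0 => if x = (fun _ : Fin P.d => (((P.L ^ j - 1) / 2 : ℕ) : ZMod (P.sitesPerDir 0))) then g else 1) i x =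
        if x = (fun _ : Fin P.d => (((P.L ^ (j - i) - 1) / 2 : ℕ) : ZMod (P.sitesPerDir i))) then g else 1
  | 0, _, x => by simp only [transfUp, Nat.sub_zero]
  | i + 1, hi, x => by
    show transfUp _ i (emb x) = _
    rw [transfUp_bump_of_le hj g i (by omega) (emb x)]
    have hn : j - i = (j - (i + 1)) + 1 := by omega
    have hc := emb_const_centre (P := P) (i := i) (n := j - (i + 1)) (by omega) (by omega)
    rw [hn, ← hc]
    by_cases hx : x = (fun _ : Fin P.d => (((P.L ^ (j - (i + 1)) - 1) / 2 : ℕ) : ZMod (P.sitesPerDir (i + 1))))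
    · rw [if_pos hx, if_pos (congrArg emb hx)]
    · rw [if_neg hx, if_neg]
      intro h
      exact hx (by simpa only [Site.blockOf_emb (by omega : i + 1 ≤ P.m + P.K)] using congrArg blockOf h)

/-- ★ **… AND DIES ABOVE LEVEL `j`**: `transfUp h i ≡ 1` for every `i > j` (the origin of `T⁽ʲ⁾` is no centre) — so the bump is RESIDUAL for every comparison
height above `j`. [cite: Balaban1985Averaging, (11)-(13) p.19] -/
theorem transfUp_bump_of_lt {j : ℕ} (hj : j + 1 ≤ P.m + P.K) (g : G) :
    ∀ (k : ℕ) (x : Site P (j + 1 + k)),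
      transfUp (fun x : Site P 0 => if x = (fun _ : Fin P.d => (((P.L ^ j - 1) / 2 : ℕ) : ZMod (P.sitesPerDir 0))) then g else 1) (j + 1 + k) x = 1
  | 0, x => by
    show transfUp _ j (emb x) = 1
    rw [transfUp_bump_of_le (by omega) g j le_rfl (emb x), if_neg (emb_ne_const_zero hj x)]
  | k + 1, x => by
    show transfUp _ (j + 1 + k) (emb x) = 1
    exact transfUp_bump_of_lt hj g k (emb x)

/-- `transfUp h i ≡ 1` for `j < i`, index-free form of the previous lemma. [cite: Balaban1985Averaging, (11)-(13) p.19] -/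
theorem transfUp_bump_eq_one {j : ℕ} (hj : j + 1 ≤ P.m + P.K) (g : G) {i : ℕ} (hi : j < i) (x : Site P i) :
    transfUp (fun x : Site P 0 => if x = (fun _ : Fin P.d => (((P.L ^ j - 1) / 2 : ℕ) : ZMod (P.sitesPerDir 0))) then g else 1) i x = 1 := by
  obtain ⟨k, rfl⟩ : ∃ k, i = j + 1 + k := ⟨i - (j + 1), by omega⟩
  exact transfUp_bump_of_lt hj g k x

end Ascent

/-! ## §3 The chart tower of the bumped history `h•U₀` against `U₀` (the cell's `T³` families, `SU(2)`, printed averaging `ℰp`) -/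
section Tower
variable (F : T3Family)

/-- The bumped history IS the consumer's `e^{ζ}·U₀` for `ζ ℓ := logVec ((h•U₀) ℓ·(U₀ ℓ)⁻¹)` (quaternionic chart, lit ✓`expPoint_logVec`). [cite: Balaban1985Averaging, (8) p.19] -/
theorem expPoint_logVec_rel_mul_eq {K : ℕ} (h : GaugeTransf (F.P K) 0 (Matrix.specialUnitaryGroup (Fin 2) ℂ))
    (U₀ : GaugeField (F.P K) 0 (Matrix.specialUnitaryGroup (Fin 2) ℂ)) :
    (fun ℓ => expPoint (logVec (su2Quat (GaugeField.gaugeAct h U₀ ℓ * (U₀ ℓ)⁻¹))) * U₀ ℓ :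
        GaugeField (F.P K) 0 (Matrix.specialUnitaryGroup (Fin 2) ℂ)) = GaugeField.gaugeAct h U₀ := by
  funext ℓ
  rw [expPoint_logVec, inv_mul_cancel_right]

/-- ★★★ **THE BUMP SURVIVES UNDILUTED AT EVERY LEVEL `i ≤ j`**: for the single-site gauge bump `h = (g at emb^j(0), 1 elsewhere)` of the finest lattice and ANY
background `U₀`, the relative field of the averaged histories `Ū^i(h•U₀)·(Ū^iU₀)⁻¹` has ℓ²-mass EXACTLY `2·3·(arc g)²` at every level `i ≤ j` — covariance
`Ū^i(h•U₀) = (transfUp h i)•Ū^iU₀` (lit ✓`iter_gaugeAct`) + §2 + §1.  At `i = 0` this is `Σ_ℓ ‖ζ ℓ‖²`. [cite: Balaban1985Averaging, (11)-(13) p.19] -/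
theorem sum_sq_relTower_bump_of_le {K j : ℕ} (hj : j ≤ F.m + K) (g : Matrix.specialUnitaryGroup (Fin 2) ℂ)
    (U₀ : GaugeField (F.P K) 0 (Matrix.specialUnitaryGroup (Fin 2) ℂ)) {i : ℕ} (hi : i ≤ j) :
    ∑ b : PBond (F.P K) i, ‖logVec (su2Quat (Averaging.iter (fun k => BlockAveraging.blockAvg (P := F.P K) (j := k) ℰp) i
        (GaugeField.gaugeAct (fun x : Site (F.P K) 0 => if x = (fun _ : Fin (F.P K).d => (((F.L ^ j - 1) / 2 : ℕ) : ZMod ((F.P K).sitesPerDir 0))) then g else 1) U₀) b *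
        (Averaging.iter (fun k => BlockAveraging.blockAvg (P := F.P K) (j := k) ℰp) i U₀ b)⁻¹))‖ ^ 2 = 2 * 3 * ‖logVec (su2Quat g)‖ ^ 2 := by
  rw [iter_gaugeAct (fun k => BlockAveraging.blockAvg (P := F.P K) (j := k) ℰp) _ i (by show i ≤ F.m + K; omega) U₀]
  have hT : transfUp (fun x : Site (F.P K) 0 => if x = (fun _ : Fin (F.P K).d => (((F.L ^ j - 1) / 2 : ℕ) : ZMod ((F.P K).sitesPerDir 0))) then g else 1) i =
      fun x : Site (F.P K) i => if x = (fun _ : Fin (F.P K).d => ((((F.P K).L ^ (j - i) - 1) / 2 : ℕ) : ZMod ((F.P K).sitesPerDir i))) then g else 1 :=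
    funext (transfUp_bump_of_le (P := F.P K) (by show j ≤ F.m + K; omega) g i hi)
  rw [hT, sum_sq_norm_logVec_rel_gaugeAct_bump]
  simp

/-- ★★ **… AND IS INVISIBLE ABOVE LEVEL `j`**: `Ū^i(h•U₀) = Ū^iU₀` for `j < i ≤ m + K` (§2: `transfUp h i ≡ 1`). [cite: Balaban1985Averaging, (11)-(13) p.19] -/
theorem iter_bump_of_lt {K j : ℕ} (hj : j + 1 ≤ F.m + K) (g : Matrix.specialUnitaryGroup (Fin 2) ℂ)
    (U₀ : GaugeField (F.P K) 0 (Matrix.specialUnitaryGroup (Fin 2) ℂ)) (k : ℕ) (hk : j + 1 + k ≤ F.m + K) :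
    Averaging.iter (fun k => BlockAveraging.blockAvg (P := F.P K) (j := k) ℰp) (j + 1 + k)
        (GaugeField.gaugeAct (fun x : Site (F.P K) 0 => if x = (fun _ : Fin (F.P K).d => (((F.L ^ j - 1) / 2 : ℕ) : ZMod ((F.P K).sitesPerDir 0))) then g else 1) U₀) =
      Averaging.iter (fun k => BlockAveraging.blockAvg (P := F.P K) (j := k) ℰp) (j + 1 + k) U₀ := by
  rw [iter_gaugeAct (fun k => BlockAveraging.blockAvg (P := F.P K) (j := k) ℰp) _ (j + 1 + k) (by show j + 1 + k ≤ F.m + K; omega) U₀]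
  have hT : transfUp (fun x : Site (F.P K) 0 => if x = (fun _ : Fin (F.P K).d => (((F.L ^ j - 1) / 2 : ℕ) : ZMod ((F.P K).sitesPerDir 0))) then g else 1) (j + 1 + k) =
      fun _ => 1 := funext (transfUp_bump_of_lt (P := F.P K) (by show j + 1 ≤ F.m + K; omega) g k)
  rw [hT]
  exact B12RTGaugeInvariance254.gaugeAct_one' _

/-- ★★ **THE BUMP IS RESIDUAL** for every comparison height `J` with `j < K − J`: `descendTo (h•U₀) = descendTo U₀` (same fibre). [cite: Balaban1985Variational, (4) p.278] -/
theorem descendTo_bump_eq {J K j : ℕ} (hJK : J ≤ K) (hjK : j < K - J) (g : Matrix.specialUnitaryGroup (Fin 2) ℂ)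
    (U₀ : GaugeField (F.P K) 0 (Matrix.specialUnitaryGroup (Fin 2) ℂ)) :
    descendTo F ℰp J K hJK (GaugeField.gaugeAct (fun x : Site (F.P K) 0 => if x = (fun _ : Fin (F.P K).d => (((F.L ^ j - 1) / 2 : ℕ) : ZMod ((F.P K).sitesPerDir 0))) then g else 1) U₀) =
      descendTo F ℰp J K hJK U₀ := by
  refine residual_of_descTransf_eq_one F hJK ?_ U₀
  funext x
  exact transfUp_bump_eq_one (P := F.P K) (by show j + 1 ≤ F.m + K; omega) g hjK _

end Tower

/-! ## §4 The no-go: no `(L^{−j}, REL)`-shaped ℓ² letter for the naked chart tower -/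
section NoGo
open Literature.MathematicalPhysics.QuantumFieldTheory.Balaban1983to89.T3DescentFibreTower (avgFun_one expMeanLogSU_E_one plaqSmall_one)

/-- `Ū^t(1) = 1` for the printed averaging (lit ✓`avgFun_one` + ✓`expMeanLogSU_E_one`, iterated). [cite: Balaban1987RG1, (0.4) p.253] -/
theorem iter_blockAvg_one (F : T3Family) (K : ℕ) :
    ∀ t : ℕ, Averaging.iter (fun k => BlockAveraging.blockAvg (P := F.P K) (j := k) ℰp) t (1 : GaugeField (F.P K) 0 (Matrix.specialUnitaryGroup (Fin 2) ℂ)) = 1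
  | 0 => rfl
  | t + 1 => by
    show (BlockAveraging.blockAvg ℰp).avg (Averaging.iter (fun k => BlockAveraging.blockAvg (P := F.P K) (j := k) ℰp) t 1) = 1
    rw [iter_blockAvg_one F K t, BlockAveraging.blockAvg_avg]
    exact avgFun_one _ expMeanLogSU_E_one

/-- ★★★ **HAZARD «L2-GAUGE», KERNEL FORM: THE DISPLAYED (L2-TOWER) LETTER IS FALSE FOR THE NAKED CHART TOWER.**  For every admissible block size `L` there are NO constants
`C₂, C₂′` such that, for every family `F` with `F.L = L`, all heights `J ≤ K`, every positive threshold profile, every good background `U₀` (good history, (BKG)-class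
plaquettes for any `C_B, α ≥ 0`), and every fluctuation `ζ` (`‖ζ‖ ≤ π`, good history, SAME FIBRE, tower in the window `1∕4` at every level), the ℓ²-mass of
✓`linBudget_of_chartTower`'s chart tower `X` (its `hXdef` text) obeys `Σ_{b : PBond (F.P K) j} ‖X j b‖² ≤ C₂·L^{−j}·Σ_ℓ‖ζ ℓ‖² + C₂′·L^{2(K−J)−j}·REL` at every `j ≤ K − J`.
Witness (§1–§3): flat `U₀ = 1`, `J = 0`, `K = j + 1` with `L^j > C₂`, the single-site gauge bump `g = exp(A)`, `‖A‖ = 1∕4`, at `emb^j(0)`: both sides' data are met,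
`REL = 0`, and `Σ_b ‖X j b‖² = Σ_ℓ ‖ζ ℓ‖² = 6·(1∕4)² > C₂·L^{−j}·6·(1∕4)²`.  (Architect RULING «L2-GAUGE» 2026-09-01T01:24:54Z, desk RULING №128.)
[cite: Balaban1985Averaging, (11)-(13) p.19; Balaban1987RG1, (0.4) p.253] -/
theorem not_l2Tower_contraction (L : ℕ) (hL : Odd L ∧ 1 < L) :
    ¬ ∃ C₂ C₂' : ℝ, ∀ (F : T3Family), F.L = L → ∀ (J K : ℕ) (hJK : J ≤ K) (θ : ℕ → ℝ), (∀ i, 0 < θ i) →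
      ∀ (C_B α : ℝ), 0 ≤ C_B → 0 ≤ α →
      ∀ U₀ : GaugeField (F.P K) 0 (Matrix.specialUnitaryGroup (Fin 2) ℂ), U₀ ∈ histGood F ℰp θ K J →
        (∀ t, t ≤ K - J → ∀ p : Plaq (F.P K) t,
          dist1 (GaugeField.plaqHol (Averaging.iter (fun k => BlockAveraging.blockAvg (P := F.P K) (j := k) ℰp) t U₀) p) ≤
            C_B * α * (F.L : ℝ) ^ (2 * t) * ((F.L : ℝ)⁻¹) ^ (2 * (K - J))) →
        ∀ ζ : PBond (F.P K) 0 → EuclideanSpace ℝ (Fin 3), (∀ ℓ, ‖ζ ℓ‖ ≤ Real.pi) →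
          (fun ℓ => expPoint (ζ ℓ) * U₀ ℓ : GaugeField (F.P K) 0 (Matrix.specialUnitaryGroup (Fin 2) ℂ)) ∈ histGood F ℰp θ K J →
          descendTo F ℰp J K hJK (fun ℓ => expPoint (ζ ℓ) * U₀ ℓ : GaugeField (F.P K) 0 (Matrix.specialUnitaryGroup (Fin 2) ℂ)) = descendTo F ℰp J K hJK U₀ →
          (∀ t, t ≤ K - J → ∀ b : PBond (F.P K) t,
            ‖logVec (su2Quat (Averaging.iter (fun k => BlockAveraging.blockAvg (P := F.P K) (j := k) ℰp) t (fun ℓ => expPoint (ζ ℓ) * U₀ ℓ : GaugeField (F.P K) 0 (Matrix.specialUnitaryGroup (Fin 2) ℂ)) b * (Averaging.iter (fun k => BlockAveraging.blockAvg (P := F.P K) (j := k) ℰp) t U₀ b)⁻¹))‖ ≤ 1 / 4) →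
          ∀ j, j ≤ K - J →
            ∑ b : PBond (F.P K) j,
              ‖(⟨su2Coord (rev (logVec (su2Quat (Averaging.iter (fun k => BlockAveraging.blockAvg (P := F.P K) (j := k) ℰp) j (fun ℓ => expPoint (ζ ℓ) * U₀ ℓ : GaugeField (F.P K) 0 (Matrix.specialUnitaryGroup (Fin 2) ℂ)) b * (Averaging.iter (fun k => BlockAveraging.blockAvg (P := F.P K) (j := k) ℰp) j U₀ b)⁻¹)))), su2Coord_rev_mem_lie _⟩ : (specialUnitaryLogChart (Fin 2)).lie)‖ ^ 2 ≤
              C₂ * ((F.L : ℝ)⁻¹) ^ j * ∑ ℓ : PBond (F.P K) 0, ‖ζ ℓ‖ ^ 2 +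
              C₂' * (F.L : ℝ) ^ (2 * (K - J) - j) * ∑ p : Plaq (F.P K) 0,
                (1 - reTr ((GaugeField.plaqHol U₀ p)⁻¹ * GaugeField.plaqHol (fun ℓ => expPoint (ζ ℓ) * U₀ ℓ : GaugeField (F.P K) 0 (Matrix.specialUnitaryGroup (Fin 2) ℂ)) p)) := by
  rintro ⟨C₂, C₂', H⟩
  have hL1 : (1 : ℝ) < (L : ℝ) := by exact_mod_cast hL.2
  obtain ⟨j, hj⟩ : ∃ j : ℕ, C₂ < (L : ℝ) ^ j := pow_unbounded_of_one_lt C₂ hL1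
  -- the family, the heights, the bump
  let F : T3Family := ⟨L, hL, 1, le_rfl⟩
  have hFL : F.L = L := rfl
  let g : Matrix.specialUnitaryGroup (Fin 2) ℂ := expPoint (EuclideanSpace.single 0 (1 / 4 : ℝ))
  have hg : ‖logVec (su2Quat g)‖ = 1 / 4 := by
    have hA : ‖EuclideanSpace.single (0 : Fin 3) (1 / 4 : ℝ)‖ = 1 / 4 := by
      simp
    rw [norm_logVec_su2Quat_expPoint (by rw [hA]; linarith [Real.pi_gt_three]), hA]
  let h : GaugeTransf (F.P (j + 1)) 0 (Matrix.specialUnitaryGroup (Fin 2) ℂ) :=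
    fun x => if x = (fun _ : Fin (F.P (j + 1)).d => (((F.L ^ j - 1) / 2 : ℕ) : ZMod ((F.P (j + 1)).sitesPerDir 0))) then g else 1
  let U₀ : GaugeField (F.P (j + 1)) 0 (Matrix.specialUnitaryGroup (Fin 2) ℂ) := 1
  let ζ : PBond (F.P (j + 1)) 0 → EuclideanSpace ℝ (Fin 3) := fun ℓ => logVec (su2Quat (GaugeField.gaugeAct h U₀ ℓ * (U₀ ℓ)⁻¹))
  have hU : (fun ℓ => expPoint (ζ ℓ) * U₀ ℓ : GaugeField (F.P (j + 1)) 0 (Matrix.specialUnitaryGroup (Fin 2) ℂ)) = GaugeField.gaugeAct h U₀ :=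
    expPoint_logVec_rel_mul_eq F h U₀
  have hiter1 : ∀ t, Averaging.iter (fun k => BlockAveraging.blockAvg (P := F.P (j + 1)) (j := k) ℰp) t U₀ = 1 := iter_blockAvg_one F (j + 1)
  -- the hypotheses of the letter at the witness
  have h1 : U₀ ∈ histGood F ℰp (fun _ => (1 : ℝ)) (j + 1) 0 := by
    intro t _
    rw [hiter1 t]
    exact plaqSmall_one one_pos
  have h2 : (fun ℓ => expPoint (ζ ℓ) * U₀ ℓ : GaugeField (F.P (j + 1)) 0 (Matrix.specialUnitaryGroup (Fin 2) ℂ)) ∈ histGood F ℰp (fun _ => (1 : ℝ)) (j + 1) 0 := by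
    rw [hU]; exact (gaugeAct_mem_histGood_iff F h (fun _ => (1 : ℝ)) 0 U₀).mpr h1
  have h3 : descendTo F ℰp 0 (j + 1) (Nat.zero_le _) (fun ℓ => expPoint (ζ ℓ) * U₀ ℓ : GaugeField (F.P (j + 1)) 0 (Matrix.specialUnitaryGroup (Fin 2) ℂ)) =
      descendTo F ℰp 0 (j + 1) (Nat.zero_le _) U₀ := by
    rw [hU]; exact descendTo_bump_eq F (Nat.zero_le _) (by omega) g U₀
  have hBKG : ∀ t, t ≤ j + 1 - 0 → ∀ p : Plaq (F.P (j + 1)) t,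
      dist1 (GaugeField.plaqHol (Averaging.iter (fun k => BlockAveraging.blockAvg (P := F.P (j + 1)) (j := k) ℰp) t U₀) p) ≤
        0 * 0 * (F.L : ℝ) ^ (2 * t) * ((F.L : ℝ)⁻¹) ^ (2 * (j + 1 - 0)) := by
    intro t _ p
    rw [hiter1 t, B15Chi124DetSets.plaqHol_one, GaugeGroup.dist1_one]; simp
  have hwin : ∀ t, t ≤ j + 1 - 0 → ∀ b : PBond (F.P (j + 1)) t,
      ‖logVec (su2Quat (Averaging.iter (fun k => BlockAveraging.blockAvg (P := F.P (j + 1)) (j := k) ℰp) t (fun ℓ => expPoint (ζ ℓ) * U₀ ℓ : GaugeField (F.P (j + 1)) 0 (Matrix.specialUnitaryGroup (Fin 2) ℂ)) b *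
        (Averaging.iter (fun k => BlockAveraging.blockAvg (P := F.P (j + 1)) (j := k) ℰp) t U₀ b)⁻¹))‖ ≤ 1 / 4 := by
    intro t ht b
    rw [hU]
    rcases Nat.lt_or_ge j t with hjt | hjt
    · have ht' : t = j + 1 + 0 := by omega
      subst ht'
      rw [iter_bump_of_lt F (by show j + 1 ≤ 1 + (j + 1 + 0); omega) g U₀ 0 (by show j + 1 + 0 ≤ 1 + (j + 1 + 0); omega), mul_inv_cancel,
        norm_logVec_su2Quat_one]
      norm_num
    · have hT : transfUp h t = fun x : Site (F.P (j + 1)) t =>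
          if x = (fun _ : Fin (F.P (j + 1)).d => (((F.L ^ (j - t) - 1) / 2 : ℕ) : ZMod ((F.P (j + 1)).sitesPerDir t))) then g else 1 :=
        funext (transfUp_bump_of_le (P := F.P (j + 1)) (by show j ≤ 1 + (j + 1); omega) g t hjt)
      rw [iter_gaugeAct (fun k => BlockAveraging.blockAvg (P := F.P (j + 1)) (j := k) ℰp) _ t (by show t ≤ 1 + (j + 1); omega) U₀,
        hT, norm_logVec_rel_gaugeAct_bump]
      split_ifs
      · rw [hg]
      · norm_num
  -- the two sides at level `j`
  have hLHS : ∑ b : PBond (F.P (j + 1)) j,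
      ‖(⟨su2Coord (rev (logVec (su2Quat (Averaging.iter (fun k => BlockAveraging.blockAvg (P := F.P (j + 1)) (j := k) ℰp) j (fun ℓ => expPoint (ζ ℓ) * U₀ ℓ : GaugeField (F.P (j + 1)) 0 (Matrix.specialUnitaryGroup (Fin 2) ℂ)) b * (Averaging.iter (fun k => BlockAveraging.blockAvg (P := F.P (j + 1)) (j := k) ℰp) j U₀ b)⁻¹)))), su2Coord_rev_mem_lie _⟩ : (specialUnitaryLogChart (Fin 2)).lie)‖ ^ 2 =
      2 * 3 * (1 / 4) ^ 2 := by
    rw [hU, ← hg, ← sum_sq_relTower_bump_of_le F (by show j ≤ 1 + (j + 1); omega) g U₀ le_rfl]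
    refine Finset.sum_congr rfl fun b _ => ?_
    show ‖su2Coord (rev (logVec (su2Quat _)))‖ ^ 2 = _
    rw [norm_su2Coord, norm_rev]
  have hζ : ∑ ℓ : PBond (F.P (j + 1)) 0, ‖ζ ℓ‖ ^ 2 = 2 * 3 * (1 / 4) ^ 2 := by
    rw [← hg]
    exact (sum_sq_norm_logVec_rel_gaugeAct_bump U₀ _ g).trans (by simp)
  have hREL : ∑ p : Plaq (F.P (j + 1)) 0,
      (1 - reTr ((GaugeField.plaqHol U₀ p)⁻¹ * GaugeField.plaqHol (fun ℓ => expPoint (ζ ℓ) * U₀ ℓ : GaugeField (F.P (j + 1)) 0 (Matrix.specialUnitaryGroup (Fin 2) ℂ)) p)) = 0 := by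
    refine Finset.sum_eq_zero fun p _ => ?_
    rw [hU, T4WilsonGaugeFlatDirection.plaqHol_gaugeAct]
    show 1 - reTr ((GaugeField.plaqHol (1 : GaugeField (F.P (j + 1)) 0 (Matrix.specialUnitaryGroup (Fin 2) ℂ)) p)⁻¹ * (h p.src * GaugeField.plaqHol (1 : GaugeField (F.P (j + 1)) 0 (Matrix.specialUnitaryGroup (Fin 2) ℂ)) p * (h p.src)⁻¹)) = 0
    rw [B15Chi124DetSets.plaqHol_one, mul_one, mul_inv_cancel, inv_one, mul_one, GaugeGroup.reTr_one, sub_self]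
  -- the letter at the witness
  have key := H F hFL 0 (j + 1) (Nat.zero_le _) (fun _ => 1) (fun _ => one_pos) 0 0 le_rfl le_rfl U₀ h1 hBKG ζ
    (fun ℓ => norm_logVec_le_pi _) h2 h3 hwin j (by omega)
  rw [hLHS, hζ, hREL, mul_zero, add_zero, hFL] at key
  -- `6/16 ≤ C₂ L^{-j} 6/16` contradicts `C₂ < L^j`
  have hLj : (0 : ℝ) < (L : ℝ) ^ j := pow_pos (by linarith) j
  have hinv : ((L : ℝ)⁻¹) ^ j * (L : ℝ) ^ j = 1 := by rw [inv_pow, inv_mul_cancel₀ hLj.ne']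
  nlinarith [hinv, hLj, hj, key]

end NoGo

end Summit.QuantumFields.YangMills.Theorems.FluctuationComparisonRegPrIntLS2BetaL2TowerContractionFalse

end
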